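import Summits.NavierStokesRegularity.NavierStokesRegularity.Theorems.CorkscrewDynamoNoSmallConstantWindDynamoSlice
import Literature.Analysis.FluidPDE.SpaceTimeCalculus
import Mathlib.Analysis.SpecialFunctions.JapaneseBracket
import HarnessLib

/-!
# The cut-off Gaussian energy of the induction equation in Leray's wind: time derivative,
# energy inequality and the Grönwall step
# (route `CorkscrewDynamo`, item `NoSmallConstantWindDynamo`, stmt-NavierStokesRegularity-11288)

Helper file (all results proved). For a jointly smooth eternal solution `Ω` of
`∂ₛΩ = curl((B + ½y) × Ω) + ΔΩ` on `ℝ × ℝ³` in the class `(1 + |y|)² |Ω(s, y)| ≤ K e^{μs}` and the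
cut-off Gaussian energies `G_R(s) = ∫ γ χ_R² |Ω(s)|²` (`γ = e^{−|y|²/4}`, `χ_R = cutoff R` of
`WholeSpaceIBP`, `‖Dχ_R‖ ≤ C/R`):

* `hasDerivAt_gaussian_cutoff_energy` — `G_R' = ∫ γ χ_R² 2⟪Ω, ∂ₛΩ⟫` (differentiation under the
  integral sign, the tree's `hasDerivAt_integral_of_support_subset`);
* `gaussian_cutoff_energy_deriv_le` — `G_R' ≤ −2κ G_R + 2 ε_R (K e^{μs})² M`, `κ = 1 − b − a/4`,
  `ε_R = Cβ/R + 3C²/R²`, `M = ∫ (1 + |y|)^{−4}` (the slice inequality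
  `integral_gaussian_cutoff_sq_inner_induction_le` of the sibling file `…Slice`, the cut-off error
  being estimated in the decay class — no bounds on derivatives of `Ω` are needed);
* `gaussian_cutoff_energy_gronwall` — the mean-value form of Grönwall on `(−∞, s₁]`:
  `e^{2κs₁} G_R(s₁) ≤ e^{2κs₀} (K e^{μs₀})² M + e^{2κs₁} 2ε_R (K e^{μs₁})² M (s₁ − s₀)`.

The limits `R → ∞`, `s₀ → −∞` are taken in the main file `…NoSmallConstantWindDynamo`.
References: Backus 1958; Davidson 2001, §5 (anti-dynamo energy bounds); folklore.
-/

noncomputable section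

open MeasureTheory Set Function Filter Topology
open scoped Laplacian InnerProductSpace RealInnerProductSpace ContDiff

namespace Summit.NavierStokesRegularity.NavierStokesRegularity.Theorems

-- the summit and its single sub-problem share the name (CONVENTIONS §1), as in every Theorems file
set_option linter.dupNamespace false

open Literature.Analysis Literature.Analysis.FluidPDE

/-! ### The anti-dynamo theorem: time dependence, Grönwall and the limits -/

section Main

variable {a b μ K : ℝ} {B : EuclideanSpace ℝ (Fin 3) → EuclideanSpace ℝ (Fin 3)} {Ω : ℝ → EuclideanSpace ℝ (Fin 3) → EuclideanSpace ℝ (Fin 3)}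

/-- **Type-I decay, squared.** `(1 + |y|)² |Ω(s, y)| ≤ K e^{μs}` gives
`|Ω(s, y)|² ≤ (K e^{μs})² (1 + |y|)^{−4}`. [folklore] -/
theorem norm_sq_le_of_weighted_bound (hK : ∀ s y, (1 + ‖y‖) ^ 2 * ‖Ω s y‖ ≤ K * Real.exp (μ * s))
    (s : ℝ) (y : EuclideanSpace ℝ (Fin 3)) :
    ‖Ω s y‖ ^ 2 ≤ (K * Real.exp (μ * s)) ^ 2 * (1 + ‖y‖) ^ (-(4 : ℝ)) := by
  have h0 : 0 < 1 + ‖y‖ := by positivity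
  have h2 : 0 < (1 + ‖y‖) ^ 2 := by positivity
  have h1 : ‖Ω s y‖ ≤ K * Real.exp (μ * s) / (1 + ‖y‖) ^ 2 := by
    rw [le_div_iff₀ h2, mul_comm]
    exact hK s y
  have h3 : (1 + ‖y‖) ^ (-(4 : ℝ)) = ((1 + ‖y‖) ^ 2)⁻¹ ^ 2 := by
    rw [Real.rpow_neg h0.le, ← inv_pow, show (4 : ℝ) = ((4 : ℕ) : ℝ) by norm_num,
      Real.rpow_natCast, ← pow_mul, inv_pow]
  rw [h3, ← mul_pow, ← div_eq_mul_inv]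
  exact pow_le_pow_left₀ (norm_nonneg _) h1 2

/-- The weight `(1 + |y|)^{−4}` is integrable on `ℝ³` (Mathlib `integrable_one_add_norm`, `4 > 3`).
[folklore] -/
theorem integrable_one_add_norm_neg_four :
    Integrable (fun y : EuclideanSpace ℝ (Fin 3) => (1 + ‖y‖) ^ (-(4 : ℝ))) := by
  refine integrable_one_add_norm ?_
  rw [finrank_euclideanSpace, Fintype.card_fin]
  norm_num

/-- **The Gaussian bound of the class.** In the class `(1 + |y|)² |Ω| ≤ K e^{μs}`, for any weight
`0 ≤ w ≤ 1` (here `w = χ²` or `w = 1`), `∫ γ w |Ω(s)|² ≤ (K e^{μs})² ∫ (1 + |y|)^{−4}`,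
`γ = e^{−|y|²/4} ≤ 1`. [folklore] -/
theorem integral_gaussian_mul_norm_sq_le (hK : ∀ s y, (1 + ‖y‖) ^ 2 * ‖Ω s y‖ ≤ K * Real.exp (μ * s))
    {w : EuclideanSpace ℝ (Fin 3) → ℝ} (hw0 : ∀ y, 0 ≤ w y) (hw1 : ∀ y, w y ≤ 1) (s : ℝ) :
    ∫ y, Real.exp (-‖y‖ ^ 2 / 4) * w y * ‖Ω s y‖ ^ 2 ≤
      (K * Real.exp (μ * s)) ^ 2 * ∫ y : EuclideanSpace ℝ (Fin 3), (1 + ‖y‖) ^ (-(4 : ℝ)) := by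
  rw [← integral_const_mul]
  refine integral_mono_of_nonneg (Eventually.of_forall fun y => ?_)
    (integrable_one_add_norm_neg_four.const_mul _) (Eventually.of_forall fun y => ?_)
  · exact mul_nonneg (mul_nonneg (Real.exp_pos _).le (hw0 y)) (sq_nonneg _)
  · have hγ1 : Real.exp (-‖y‖ ^ 2 / 4) * w y ≤ 1 := by
      have : Real.exp (-‖y‖ ^ 2 / 4) ≤ 1 := Real.exp_le_one_iff.2 (by
        have := sq_nonneg ‖y‖; linarith)
      exact mul_le_one₀ this (hw0 y) (hw1 y)
    calc Real.exp (-‖y‖ ^ 2 / 4) * w y * ‖Ω s y‖ ^ 2 ≤ 1 * ‖Ω s y‖ ^ 2 :=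
          mul_le_mul_of_nonneg_right hγ1 (sq_nonneg _)
      _ ≤ (K * Real.exp (μ * s)) ^ 2 * (1 + ‖y‖) ^ (-(4 : ℝ)) := by
          rw [one_mul]; exact norm_sq_le_of_weighted_bound hK s y

/-- **The cut-off Gaussian energy is differentiable in time**, with
`d/ds ∫ γ χ_R² |Ω(s)|² = ∫ γ χ_R² · 2⟪Ω, ∂ₛΩ⟫` (differentiation under the integral sign for the
jointly smooth field against the compactly supported weight `γ χ_R²`; the tree's
`hasDerivAt_integral_of_support_subset`). [folklore] -/
theorem hasDerivAt_gaussian_cutoff_energy (hΩ : IsSmoothSpaceTimeOn univ Ω) {R : ℝ} (hR : 0 < R)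
    (s : ℝ) :
    HasDerivAt (fun τ => ∫ y, Real.exp (-‖y‖ ^ 2 / 4) * cutoff R y ^ 2 * ‖Ω τ y‖ ^ 2)
      (∫ y, Real.exp (-‖y‖ ^ 2 / 4) * cutoff R y ^ 2 *
        (2 * ⟪Ω s y, deriv (fun τ => Ω τ y) s⟫)) s := by
  set φ : EuclideanSpace ℝ (Fin 3) → ℝ := fun y => Real.exp (-‖y‖ ^ 2 / 4) * cutoff R y ^ 2 with hφdef
  have hφ : ContDiff ℝ ∞ φ := contDiff_gaussianWeightFun.mul ((contDiff_cutoff (n := ⊤) R).pow 2)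
  have hΦ : IsSmoothSpaceTimeOn univ (fun τ y => φ y * ⟪Ω τ y, Ω τ y⟫) :=
    (isSmoothSpaceTimeOn_const_time hφ univ).mul (hΩ.inner hΩ)
  have hsupp : ∀ τ ∈ (univ : Set ℝ), ∀ y ∉ tsupport (cutoff R), φ y * ⟪Ω τ y, Ω τ y⟫ = 0 :=
    fun τ _ y hy => by simp [hφdef, image_eq_zero_of_notMem_tsupport hy]
  have hD := hasDerivAt_integral_of_support_subset (μ := volume) isOpen_univ hΦ
    (hasCompactSupport_cutoff hR) hsupp (mem_univ s)
  have e1 : (fun τ => ∫ y, φ y * ⟪Ω τ y, Ω τ y⟫) =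
      fun τ => ∫ y, Real.exp (-‖y‖ ^ 2 / 4) * cutoff R y ^ 2 * ‖Ω τ y‖ ^ 2 := by
    funext τ
    refine integral_congr_ae (Eventually.of_forall fun y => ?_)
    simp only [hφdef, real_inner_self_eq_norm_sq]
  have e2 : ∫ y, deriv (fun τ => φ y * ⟪Ω τ y, Ω τ y⟫) s =
      ∫ y, Real.exp (-‖y‖ ^ 2 / 4) * cutoff R y ^ 2 * (2 * ⟪Ω s y, deriv (fun τ => Ω τ y) s⟫) := by
    refine integral_congr_ae (Eventually.of_forall fun y => ?_)
    have hl : HasDerivAt (fun τ => Ω τ y) (deriv (fun τ => Ω τ y) s) s :=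
      hΩ.hasDerivAt_timeLine isOpen_univ (mem_univ s) y
    have h2 := ((hl.inner ℝ hl).const_mul (φ y)).deriv
    show deriv (fun τ => φ y * ⟪Ω τ y, Ω τ y⟫) s =
      Real.exp (-‖y‖ ^ 2 / 4) * cutoff R y ^ 2 * (2 * ⟪Ω s y, deriv (fun τ => Ω τ y) s⟫)
    rw [h2, hφdef, real_inner_comm]
    ring
  rw [e1, e2] at hD
  exact hD

/-- **The energy inequality of the cut-off Gaussian energy.** For the induction equation
`∂ₛΩ = curl((B + ½y) × Ω) + ΔΩ` in Leray's wind with `|y||B| ≤ a`, `‖DB‖ ≤ b`, `|B| ≤ β`,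
in the class `(1 + |y|)²|Ω| ≤ K e^{μs}`, and the cut-off `χ_R` (`‖Dχ_R‖ ≤ C/R`):
`d/ds ∫ γχ_R²|Ω|² ≤ −2(1 − b − a/4) ∫ γχ_R²|Ω|² + 2 ε_R (K e^{μs})² ∫(1+|y|)^{−4}`,
`ε_R = Cβ/R + 3C²/R²` (the slice inequality `integral_gaussian_cutoff_sq_inner_induction_le`, the
cut-off error being estimated in the decay class). [folklore] -/
theorem gaussian_cutoff_energy_deriv_le (hB : ContDiff ℝ 1 B) (hdivB : VectorCalculus.IsDivFree B)
    (ha : ∀ y, ‖y‖ * ‖B y‖ ≤ a) (hb : ∀ y, ‖fderiv ℝ B y‖ ≤ b) {β : ℝ} (hβ : ∀ y, ‖B y‖ ≤ β)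
    (hΩ : IsSmoothSpaceTimeOn univ Ω) (hdivΩ : ∀ s, VectorCalculus.IsDivFree (Ω s))
    (hpde : ∀ s y, deriv (fun τ => Ω τ y) s =
      curl (fun z => cross (B z + (1 / 2 : ℝ) • z) (Ω s z)) y + (Δ (Ω s)) y)
    (hK : ∀ s y, (1 + ‖y‖) ^ 2 * ‖Ω s y‖ ≤ K * Real.exp (μ * s))
    {C R : ℝ} (hR : 0 < R) (hC : ∀ y : EuclideanSpace ℝ (Fin 3), ‖fderiv ℝ (cutoff R) y‖ ≤ C / R) (s : ℝ) :
    ∫ y, Real.exp (-‖y‖ ^ 2 / 4) * cutoff R y ^ 2 * (2 * ⟪Ω s y, deriv (fun τ => Ω τ y) s⟫) ≤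
      -(2 * (1 - b - a / 4)) * (∫ y, Real.exp (-‖y‖ ^ 2 / 4) * cutoff R y ^ 2 * ‖Ω s y‖ ^ 2)
        + 2 * ((C / R * β + 3 * (C / R) ^ 2) *
            ((K * Real.exp (μ * s)) ^ 2 * ∫ y : EuclideanSpace ℝ (Fin 3), (1 + ‖y‖) ^ (-(4 : ℝ)))) := by
  have hΩs : ContDiff ℝ 2 (Ω s) := (hΩ.contDiff_slice (mem_univ s)).of_le (by norm_cast)
  have hslice := integral_gaussian_cutoff_sq_inner_induction_le hB hdivB ha hb hΩs (hdivΩ s)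
    (contDiff_cutoff (n := 1) R) (hasCompactSupport_cutoff hR) (abs_cutoff_le_one R)
  -- insert the equation
  have e1 : ∫ y, Real.exp (-‖y‖ ^ 2 / 4) * cutoff R y ^ 2 * (2 * ⟪Ω s y, deriv (fun τ => Ω τ y) s⟫) =
      2 * ∫ y, Real.exp (-‖y‖ ^ 2 / 4) * cutoff R y ^ 2 *
        ⟪Ω s y, curl (fun z => cross (B z + (1 / 2 : ℝ) • z) (Ω s z)) y + (Δ (Ω s)) y⟫ := by
    rw [← integral_const_mul]
    refine integral_congr_ae (Eventually.of_forall fun y => ?_)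
    simp only [hpde s y]
    ring
  -- the cut-off error in the decay class
  have hCR : 0 ≤ C / R := (norm_nonneg _).trans (hC 0)
  have herr : ∫ y, Real.exp (-‖y‖ ^ 2 / 4) *
      ((‖fderiv ℝ (cutoff R) y‖ * ‖B y‖ + 3 * ‖fderiv ℝ (cutoff R) y‖ ^ 2) * ‖Ω s y‖ ^ 2) ≤
      (C / R * β + 3 * (C / R) ^ 2) *
        ((K * Real.exp (μ * s)) ^ 2 * ∫ y : EuclideanSpace ℝ (Fin 3), (1 + ‖y‖) ^ (-(4 : ℝ))) := by
    rw [← integral_const_mul, ← integral_const_mul]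
    refine integral_mono_of_nonneg (Eventually.of_forall fun y => ?_)
      ((integrable_one_add_norm_neg_four.const_mul _).const_mul _) (Eventually.of_forall fun y => ?_)
    · exact mul_nonneg (Real.exp_pos _).le (mul_nonneg (by positivity) (sq_nonneg _))
    · have hγ1 : Real.exp (-‖y‖ ^ 2 / 4) ≤ 1 := Real.exp_le_one_iff.2 (by
        have := sq_nonneg ‖y‖; linarith)
      have hP : ‖fderiv ℝ (cutoff R) y‖ * ‖B y‖ + 3 * ‖fderiv ℝ (cutoff R) y‖ ^ 2 ≤
          C / R * β + 3 * (C / R) ^ 2 := by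
        have h1 : ‖fderiv ℝ (cutoff R) y‖ * ‖B y‖ ≤ C / R * β :=
          mul_le_mul (hC y) (hβ y) (norm_nonneg _) hCR
        have h2 : ‖fderiv ℝ (cutoff R) y‖ ^ 2 ≤ (C / R) ^ 2 :=
          pow_le_pow_left₀ (norm_nonneg _) (hC y) 2
        linarith
      have hP0 : 0 ≤ ‖fderiv ℝ (cutoff R) y‖ * ‖B y‖ + 3 * ‖fderiv ℝ (cutoff R) y‖ ^ 2 := by
        positivity
      have hQ := norm_sq_le_of_weighted_bound hK s y
      calc Real.exp (-‖y‖ ^ 2 / 4) *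
            ((‖fderiv ℝ (cutoff R) y‖ * ‖B y‖ + 3 * ‖fderiv ℝ (cutoff R) y‖ ^ 2) * ‖Ω s y‖ ^ 2)
          ≤ 1 * ((‖fderiv ℝ (cutoff R) y‖ * ‖B y‖ + 3 * ‖fderiv ℝ (cutoff R) y‖ ^ 2) * ‖Ω s y‖ ^ 2) :=
            mul_le_mul_of_nonneg_right hγ1 (mul_nonneg hP0 (sq_nonneg _))
        _ ≤ (C / R * β + 3 * (C / R) ^ 2) * ((K * Real.exp (μ * s)) ^ 2 * (1 + ‖y‖) ^ (-(4 : ℝ))) := by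
            rw [one_mul]
            exact mul_le_mul hP hQ (sq_nonneg _) (hP0.trans hP)
  rw [e1]
  linarith

/-- **Grönwall step (mean value form).** Under the hypotheses of
`gaussian_cutoff_energy_deriv_le`, with `κ = 1 − b − a/4 > 0`, `μ ≥ 0`, the weighted energy
`F(s) = e^{2κs} ∫ γχ_R²|Ω(s)|²` has `F' ≤ e^{2κs₁} · 2ε_R (K e^{μs₁})² M` on `(−∞, s₁]`
(`M = ∫(1+|y|)^{−4}`), hence for `s₀ ≤ s₁`
`e^{2κs₁} ∫ γχ_R²|Ω(s₁)|² ≤ e^{2κs₀} (K e^{μs₀})² M + e^{2κs₁} 2ε_R (K e^{μs₁})² M (s₁ − s₀)`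
(Mathlib `Convex.image_sub_le_mul_sub_of_deriv_le`). [folklore] -/
theorem gaussian_cutoff_energy_gronwall (hB : ContDiff ℝ 1 B) (hdivB : VectorCalculus.IsDivFree B)
    (ha : ∀ y, ‖y‖ * ‖B y‖ ≤ a) (hb : ∀ y, ‖fderiv ℝ B y‖ ≤ b) (hab : b + a / 4 < 1)
    {β : ℝ} (hβ : ∀ y, ‖B y‖ ≤ β) (hμ : 0 ≤ μ)
    (hΩ : IsSmoothSpaceTimeOn univ Ω) (hdivΩ : ∀ s, VectorCalculus.IsDivFree (Ω s))
    (hpde : ∀ s y, deriv (fun τ => Ω τ y) s =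
      curl (fun z => cross (B z + (1 / 2 : ℝ) • z) (Ω s z)) y + (Δ (Ω s)) y)
    (hK : ∀ s y, (1 + ‖y‖) ^ 2 * ‖Ω s y‖ ≤ K * Real.exp (μ * s))
    {C R : ℝ} (hR : 0 < R) (hC : ∀ y : EuclideanSpace ℝ (Fin 3), ‖fderiv ℝ (cutoff R) y‖ ≤ C / R) {s₀ s₁ : ℝ}
    (hs : s₀ ≤ s₁) :
    Real.exp (2 * (1 - b - a / 4) * s₁) *
        ∫ y, Real.exp (-‖y‖ ^ 2 / 4) * cutoff R y ^ 2 * ‖Ω s₁ y‖ ^ 2 ≤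
      Real.exp (2 * (1 - b - a / 4) * s₀) *
          ((K * Real.exp (μ * s₀)) ^ 2 * ∫ y : EuclideanSpace ℝ (Fin 3), (1 + ‖y‖) ^ (-(4 : ℝ)))
        + Real.exp (2 * (1 - b - a / 4) * s₁) * (2 * ((C / R * β + 3 * (C / R) ^ 2) *
            ((K * Real.exp (μ * s₁)) ^ 2 * ∫ y : EuclideanSpace ℝ (Fin 3), (1 + ‖y‖) ^ (-(4 : ℝ))))) * (s₁ - s₀) := by
  set κ := 1 - b - a / 4 with hκ
  set M := ∫ y : EuclideanSpace ℝ (Fin 3), (1 + ‖y‖) ^ (-(4 : ℝ)) with hM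
  set ε := C / R * β + 3 * (C / R) ^ 2 with hε
  have hκ0 : 0 < κ := by rw [hκ]; linarith
  -- the energy, its derivative and the weighted energy
  set G : ℝ → ℝ := fun τ => ∫ y, Real.exp (-‖y‖ ^ 2 / 4) * cutoff R y ^ 2 * ‖Ω τ y‖ ^ 2 with hG
  set D : ℝ → ℝ := fun τ => ∫ y, Real.exp (-‖y‖ ^ 2 / 4) * cutoff R y ^ 2 *
    (2 * ⟪Ω τ y, deriv (fun τ' => Ω τ' y) τ⟫) with hD
  have hGD : ∀ τ, HasDerivAt G (D τ) τ := fun τ => hasDerivAt_gaussian_cutoff_energy hΩ hR τ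
  have hDle : ∀ τ, D τ ≤ -(2 * κ) * G τ + 2 * (ε * ((K * Real.exp (μ * τ)) ^ 2 * M)) := fun τ =>
    gaussian_cutoff_energy_deriv_le hB hdivB ha hb hβ hΩ hdivΩ hpde hK hR hC τ
  set F : ℝ → ℝ := fun τ => Real.exp (2 * κ * τ) * G τ with hF
  have hexp : ∀ τ, HasDerivAt (fun τ => Real.exp (2 * κ * τ)) (Real.exp (2 * κ * τ) * (2 * κ)) τ := by
    intro τ
    have h := ((hasDerivAt_id τ).const_mul (2 * κ)).exp
    simp only [id, mul_one] at h
    exact h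
  have hFD : ∀ τ, HasDerivAt F (Real.exp (2 * κ * τ) * (2 * κ) * G τ + Real.exp (2 * κ * τ) * D τ) τ :=
    fun τ => (hexp τ).mul (hGD τ)
  -- nonnegativity of `K` and `ε`, monotonicity in `τ ≤ s₁`
  have hK0 : 0 ≤ K := by
    have h := hK 0 0
    rw [mul_zero, Real.exp_zero, mul_one] at h
    exact le_trans (by positivity) h
  have hCR : 0 ≤ C / R := (norm_nonneg _).trans (hC 0)
  have hβ0 : 0 ≤ β := (norm_nonneg _).trans (hβ 0)
  have hε0 : 0 ≤ ε := add_nonneg (mul_nonneg hCR hβ0) (by positivity)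
  have hM0 : 0 ≤ M := integral_nonneg fun y => Real.rpow_nonneg (by positivity) _
  -- the derivative bound on `(−∞, s₁]`
  set L := Real.exp (2 * κ * s₁) * (2 * (ε * ((K * Real.exp (μ * s₁)) ^ 2 * M))) with hL
  have hbound : ∀ τ, τ ≤ s₁ → Real.exp (2 * κ * τ) * (2 * κ) * G τ + Real.exp (2 * κ * τ) * D τ ≤ L := by
    intro τ hτ
    have h1 : Real.exp (2 * κ * τ) * (2 * κ) * G τ + Real.exp (2 * κ * τ) * D τ ≤
        Real.exp (2 * κ * τ) * (2 * (ε * ((K * Real.exp (μ * τ)) ^ 2 * M))) := by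
      have := mul_le_mul_of_nonneg_left (hDle τ) (Real.exp_pos (2 * κ * τ)).le
      nlinarith [this]
    have h2 : Real.exp (2 * κ * τ) ≤ Real.exp (2 * κ * s₁) :=
      Real.exp_le_exp.2 (mul_le_mul_of_nonneg_left hτ (by positivity))
    have h3 : (K * Real.exp (μ * τ)) ^ 2 ≤ (K * Real.exp (μ * s₁)) ^ 2 :=
      pow_le_pow_left₀ (by positivity) (mul_le_mul_of_nonneg_left
        (Real.exp_le_exp.2 (mul_le_mul_of_nonneg_left hτ hμ)) hK0) 2
    have h4 : 2 * (ε * ((K * Real.exp (μ * τ)) ^ 2 * M)) ≤ 2 * (ε * ((K * Real.exp (μ * s₁)) ^ 2 * M)) := by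
      gcongr
    calc _ ≤ Real.exp (2 * κ * τ) * (2 * (ε * ((K * Real.exp (μ * τ)) ^ 2 * M))) := h1
      _ ≤ Real.exp (2 * κ * s₁) * (2 * (ε * ((K * Real.exp (μ * s₁)) ^ 2 * M))) :=
          mul_le_mul h2 h4 (by positivity) (Real.exp_pos _).le
  -- the mean value inequality on `Iic s₁`
  have hmvt := (convex_Iic s₁).image_sub_le_mul_sub_of_deriv_le
    (f := F) (fun x _ => (hFD x).continuousAt.continuousWithinAt)
    (fun x _ => (hFD x).differentiableAt.differentiableWithinAt)
    (C := L) (fun x hx => by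
      rw [(hFD x).deriv]
      have hx' : x ∈ Iic s₁ := interior_subset hx
      exact hbound x hx') s₀ (mem_Iic.2 hs) s₁ (mem_Iic.2 le_rfl) hs
  -- the initial bound `F s₀ ≤ e^{2κs₀} (K e^{μ s₀})² M`
  have hF0 : F s₀ ≤ Real.exp (2 * κ * s₀) * ((K * Real.exp (μ * s₀)) ^ 2 * M) :=
    mul_le_mul_of_nonneg_left (integral_gaussian_mul_norm_sq_le hK (fun y => sq_nonneg _)
      (fun y => by
        have := abs_cutoff_le_one R y
        rw [← sq_abs]; nlinarith [abs_nonneg (cutoff R y)]) s₀) (Real.exp_pos _).le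
  have : F s₁ ≤ F s₀ + L * (s₁ - s₀) := by linarith
  calc Real.exp (2 * κ * s₁) * G s₁ = F s₁ := rfl
    _ ≤ Real.exp (2 * κ * s₀) * ((K * Real.exp (μ * s₀)) ^ 2 * M) + L * (s₁ - s₀) := by linarith

end Main

end Summit.NavierStokesRegularity.NavierStokesRegularity.Theorems

end
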